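import Summits.ResolutionOfSingularities.ResolutionOfSingularities.Theorems.FrobeniusClosingSteerHevLeafWords
import Summits.ResolutionOfSingularities.ResolutionOfSingularities.Theorems.FrobeniusClosingSteerWords06SteeredVocab
import Summits.ResolutionOfSingularities.ResolutionOfSingularities.Theorems.FrobeniusClosingSteerAutoPermissibleTwo
import Literature.AlgebraicGeometry.Resolution.RegularLocalHeights
import Literature.AlgebraicGeometry.Resolution.RegularLocalRingsQuotient
import Literature.AlgebraicGeometry.Resolution.RegularLocalRingsUFD
import Mathlib.FieldTheory.KummerPolynomial
import Mathlib.FieldTheory.Perfect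
import HarnessLib

/-!
# Crux `Steer` (stmt-ResolutionOfSingularities-16345), chain W4.1 — LEMMA M, the RING-LEVEL block (M2a)(M2b)(M2c)(M2d)(M2)(M3)(M3′): the singular divisor of a radicand form `f = a² + b²·f'`, σ_top legality of the point step, and the cleaned-order bound

OURS (campaign `res-hironaka`, rung L ★L-G4, slot W4.1; seat res-D-lib-2 g10 = P5a on res-L0-w41-plan-1 RULINGS 194d / 198(a) /
201(b) «FILE GO»; signatures VERBATIM from res-L0-w41-strat-2's `L/res-L0-w41-strat-2/M2/M2M4_signature.lean` v1.1 sha16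
56cbe2afe3a8d0c9, audited TRUE AS TYPED by res-L0-w41-tri-3 row R-AM 17:06:56Z / 17:17:49Z; (M2d) placed in this file per strat-2
NOTE 7 and tri-3 (1)). Candidates, not facts; nothing here is a statement of H. Hironaka's manuscript [Hironaka2017] (status: under
review). AI-written proofs; AI review is weaker than expert review.

WHAT. For a member `R ⊆ K` of the σ_top-steered `p = 2` run (tree predicates `Words.IsSingPrime` / `IsTopSingComponent` /
`IsPermissibleCentre` / `IsSigmaTopCentre` of `…Words06SteeredVocab`, `HevLeaf.CleanedOrderEq` of `…HevLeafWords`) and a radicand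
written `f = a² + b²·f'` (the shape (M1) `…MaxGenDictionary` extracts from a NON-maximal generator):
* (M2a) `isSingPrime_span_of_sqForm` — over a regular local member, `T² = f` is SINGULAR along every prime divisor `(h)`, `h ∣ b`
  (`f − a² = b²f' ∈ (h)²` + res-type-082's criterion `AutoPermissible.singular_atPrime_of_sub_pow_mem_sq`);
* (M2b) `not_isSingPrime_bot` — PURITY: if `f` is not a square in `Frac R = R_⊥` then `⊥` is not singular (`R_⊥[T]/(T² − f)` is a field);
* (M2c) `isTopSingComponent_span_of_sqForm` — `(h)` is a TOP singular component: minimal (Krull's principal ideal theorem + purity) and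
  of maximal dimension (dimension formula `ht Q + dim R/Q = dim R` of a regular local ring, `Res.height_add_ringKrullDim_quotient`);
* (M2d) `mem_maximalIdeal_sq_of_isSigmaTopCentre` — if the σ_top centre is the CLOSED POINT then every prime factor `h` of `b` lies in
  `𝔪²`: otherwise `R ⧸ (h)` is regular (`Res.IsRegularLocalRing.quotient_span_singleton`), `(h) ≠ 𝔪` (`dim R ≥ 2`), so `(h)` is a
  permissible centre — read AS WORDED in `IsSigmaTopCentre`, whose first disjunct needs `P ≠ 𝔪` and whose second forbids any
  permissible centre;
* (M2) `sqForm_coeff_mem_maximalIdeal_sq` — hence `b ∈ 𝔪²` (regular local ⇒ UFD, `Res.uniqueFactorizationMonoid_of_isRegularLocalRing`,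
  Auslander–Buchsbaum, applied to a prime factor of `b`);
* (M3) `two_mul_add_one_le_of_sqForm` — over a PERFECT residue field of characteristic `2`, `f' ≡ c²`, and
  `f − (a + bc)² = b²(f' − c²) ∈ 𝔪^(2μ+1)` against the exactness clause of `CleanedOrderEq R f (2e)`: `2μ + 1 ≤ 2e`;
* (M3′) `not_sqForm_of_cleanedOrderEq_four` — no divisor shadow at cleaned order `4` ((M3) at `μ = e = 2`).
P5b (`…MaxGenShadowRun.lean`: (M3″) `isMaxGenAt_of_point_step_four`, (M4) `concl_of_shadow_member`) is res-D-pv-040's.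
-/

set_option linter.dupNamespace false

open IsLocalRing Polynomial
open Summit.ResolutionOfSingularities.ResolutionOfSingularities.Theorems.SwitchingDichotomy.Words
open Summit.ResolutionOfSingularities.ResolutionOfSingularities.Theorems.SwitchingDichotomy.HevLeaf (CleanedOrderEq)

namespace Summit.ResolutionOfSingularities.ResolutionOfSingularities.Theorems.SwitchingDichotomy.MaxGenShadow

variable {K : Type} [Field K]

/-! ### (M3) the cleaned-order bound -/

/-- Over a PERFECT residue field of characteristic `2`, every element is a square modulo `𝔪` (private copy of
`BetaNewton.exists_sq_sub_mem_maximalIdeal`, kept private to avoid importing the Newton-polygon files). [folklore] -/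
private theorem exists_sq_sub_mem_maximalIdeal' {S : Type} [CommRing S] [IsLocalRing S] [CharP S 2]
    (hperf : PerfectField (ResidueField S)) (γ : S) : ∃ ξ : S, ξ ^ 2 - γ ∈ maximalIdeal S := by
  haveI := hperf
  haveI : CharP (ResidueField S) 2 := by
    refine (CharP.charP_iff_prime_eq_zero Nat.prime_two).mpr ?_
    have h : ((2 : ℕ) : S) = 0 := CharP.cast_eq_zero S 2
    rw [← map_natCast (residue S) 2, h, map_zero]
  haveI : ExpChar (ResidueField S) 2 := ExpChar.prime Nat.prime_two
  haveI : PerfectRing (ResidueField S) 2 := PerfectField.toPerfectRing 2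
  obtain ⟨s, hs⟩ := surjective_frobenius (ResidueField S) 2 (residue S γ)
  obtain ⟨ξ, rfl⟩ := residue_surjective s
  refine ⟨ξ, ?_⟩
  rw [← residue_eq_zero_iff, map_sub, map_pow, sub_eq_zero]
  simpa [frobenius_def] using hs

/-- **(M3)** If `f = a² + b²·f'` with `b ∈ 𝔪^μ`, the residue field is perfect (I3) (so `f' ≡ c²`), and `f` has cleaned order EXACTLY `2e`,
then `2μ + 1 ≤ 2e` (`f − (a + b c)² = b²(f' − c²) ∈ 𝔪^(2μ+1)` against the exactness clause). OURS. [folklore] -/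
theorem two_mul_add_one_le_of_sqForm [CharP K 2] (R : Subring K) [IsLocalRing R] (hI3 : PerfectField (ResidueField R))
    {f a b f' : R} (hf : f = a ^ 2 + b ^ 2 * f') {μ e : ℕ} (hμ : b ∈ maximalIdeal R ^ μ)
    (hE : CleanedOrderEq R f (2 * e)) : 2 * μ + 1 ≤ 2 * e := by
  obtain ⟨c, hc⟩ := exists_sq_sub_mem_maximalIdeal' hI3 f'
  have h2 : (2 : R) = 0 := CharTwo.two_eq_zero
  have hkey : f - (a + b * c) ^ 2 = b ^ 2 * (f' - c ^ 2) := by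
    linear_combination hf + (-(a * b * c)) * h2
  have hmem : f - (a + b * c) ^ 2 ∈ maximalIdeal R ^ (2 * μ + 1) := by
    rw [hkey, pow_succ]
    refine Ideal.mul_mem_mul ?_ ?_
    · rw [mul_comm, pow_mul]
      exact Ideal.pow_mem_pow hμ 2
    · rw [← neg_sub]
      exact (maximalIdeal R).neg_mem hc
  by_contra hlt
  have hle : maximalIdeal R ^ (2 * μ + 1) ≤ maximalIdeal R ^ (2 * e + 1) :=
    Ideal.pow_le_pow_right (by omega)
  exact hE.2 (a + b * c) (hle hmem)

/-- **(M3′)** NO DIVISOR SHADOW AT CLEANED ORDER 4: (M3) at `μ = e = 2`. OURS. [folklore] -/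
theorem not_sqForm_of_cleanedOrderEq_four [CharP K 2] (R : Subring K) [IsLocalRing R] (hI3 : PerfectField (ResidueField R))
    {f a b f' : R} (hf : f = a ^ 2 + b ^ 2 * f') (hb : b ∈ maximalIdeal R ^ 2) (hE : CleanedOrderEq R f 4) : False := by
  have h := two_mul_add_one_le_of_sqForm R hI3 hf (μ := 2) (e := 2) hb hE
  omega

/-! ### (M2b) purity -/

/-- **(M2b)** PURITY (I1) in elementwise form: if `f` is not a square in `Frac R = R_⊥`, then `⊥` is not a singular prime
(`Frac R [T]/(T² − f)` is a field). OURS. [folklore] -/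
theorem not_isSingPrime_bot (R : Subring K) (f : R)
    (hI1 : ∀ c : Localization.AtPrime (⊥ : Ideal R), algebraMap R (Localization.AtPrime (⊥ : Ideal R)) f ≠ c ^ 2) :
    ¬ IsSingPrime R 2 f ⊥ := by
  intro hsing
  apply hsing
  haveI : IsFractionRing R (Localization.AtPrime (⊥ : Ideal R)) := by
    show IsLocalization (nonZeroDivisors R) (Localization.AtPrime (⊥ : Ideal R))
    rw [← Ideal.primeCompl_bot]
    infer_instance
  letI : Field (Localization.AtPrime (⊥ : Ideal R)) := IsFractionRing.toField R
  have hirr : Irreducible (X ^ 2 - C (algebraMap R (Localization.AtPrime (⊥ : Ideal R)) f)) :=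
    X_pow_sub_C_irreducible_of_prime Nat.prime_two fun c hc => hI1 c hc.symm
  haveI : Fact (Irreducible (X ^ 2 - C (algebraMap R (Localization.AtPrime (⊥ : Ideal R)) f))) := ⟨hirr⟩
  letI : Field (RadicandRing (Localization.AtPrime (⊥ : Ideal R)) 2
      (algebraMap R (Localization.AtPrime (⊥ : Ideal R)) f)) := AdjoinRoot.instField
  infer_instance

/-! ### (M2a) the singular divisor -/

/-- **(M2a)** (signature v1.1: the standing regularity input (I2) explicit) A radicand of
the form `f = a² + b²·f'` over a regular local member is SINGULAR along every prime divisor `(h)` with `h ∣ b`: `f − a² = b² f' ∈ (h)²`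
(characteristic `2`) and `AutoPermissible.singular_atPrime_of_sub_pow_mem_sq`. OURS. [folklore] -/
theorem isSingPrime_span_of_sqForm [CharP K 2] (R : Subring K) [IsLocalRing R] (hI2 : IsRegularLocalRing R)
    {f a b f' : R} (hf : f = a ^ 2 + b ^ 2 * f')
    {h : R} (hhb : h ∣ b) [(Ideal.span {h}).IsPrime] : IsSingPrime R 2 f (Ideal.span {h}) := by
  haveI := hI2
  obtain ⟨c, rfl⟩ := hhb
  have hmem : f - a ^ 2 ∈ Ideal.span {h} ^ 2 := by
    have : f - a ^ 2 = h ^ 2 * (c ^ 2 * f') := by rw [hf]; ring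
    rw [this]
    exact Ideal.mul_mem_right _ _ (Ideal.pow_mem_pow (Ideal.mem_span_singleton_self h) 2)
  exact AutoPermissible.singular_atPrime_of_sub_pow_mem_sq K 2 R f (Ideal.span {h}) hmem

/-! ### (M2c) the singular divisor is a top singular component -/

/-- **(M2c)** Under purity (I1) and regularity (I2), the prime divisor `(h)`, `h ∣ b`, of a radicand form `f = a² + b²·f'` is a
TOP-DIMENSIONAL COMPONENT of the singular locus (minimal by Krull's principal ideal theorem + (I1); of maximal dimension `dim R − 1`,
dimension formula of a regular local ring). OURS. [folklore] -/
theorem isTopSingComponent_span_of_sqForm [CharP K 2] (R : Subring K) [IsLocalRing R] (hI2 : IsRegularLocalRing R)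
    {f a b f' : R} (hf : f = a ^ 2 + b ^ 2 * f') (hI1 : ¬ IsSingPrime R 2 f ⊥)
    {h : R} (hprime : Prime h) (hhb : h ∣ b) : IsTopSingComponent R 2 f (Ideal.span {h}) := by
  haveI := hI2
  haveI hP : (Ideal.span {h}).IsPrime := (Ideal.span_singleton_prime hprime.ne_zero).mpr hprime
  -- the height of `(h)` is one
  have hh1 : (Ideal.span {h}).height = 1 :=
    Ideal.height_span_singleton_eq_one_of_mem_nonZeroDivisors (mem_nonZeroDivisors_of_ne_zero hprime.ne_zero)
      hprime.not_unit
  -- a singular prime is not `⊥` (purity), hence has height `≥ 1`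
  have hne : ∀ (Q : Ideal R) [Q.IsPrime], IsSingPrime R 2 f Q → Q ≠ ⊥ := by
    intro Q _ hQ hbot
    subst hbot
    exact hI1 hQ
  have hge : ∀ (Q : Ideal R) [Q.IsPrime], IsSingPrime R 2 f Q → 1 ≤ Q.height := by
    intro Q _ hQ
    exact Order.one_le_iff_ne_zero.mpr fun h0 => hne Q hQ (Ideal.height_eq_zero_iff_eq_bot.mp h0)
  refine ⟨hP, isSingPrime_span_of_sqForm R hI2 hf hhb, fun Q _ hQ hle => ?_, fun Q _ hQ _ => ?_⟩
  · -- minimality among singular primes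
    by_contra hneq
    have hlt : Q.height < (Ideal.span {h}).height :=
      Ideal.height_strict_mono_of_isPrime (lt_of_le_of_ne hle hneq)
    rw [hh1] at hlt
    exact absurd (lt_of_le_of_lt (hge Q hQ) hlt) (lt_irrefl _)
  · -- maximal dimension among the (minimal) singular primes
    have h1 := hge Q hQ
    obtain ⟨c, hc⟩ := Literature.AlgebraicGeometry.Resolution.exists_nat_cast_eq_ringKrullDim (R := R)
    obtain ⟨m', hm'⟩ := ENat.ne_top_iff_exists.mp (Q.height_ne_top (Ideal.IsPrime.ne_top ‹_›))
    haveI : Nontrivial (R ⧸ Q) := Ideal.Quotient.nontrivial_iff.mpr (Ideal.IsPrime.ne_top ‹_›)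
    haveI : Nontrivial (R ⧸ Ideal.span {h}) := Ideal.Quotient.nontrivial_iff.mpr hP.ne_top
    haveI : IsLocalRing (R ⧸ Q) := .of_surjective' _ Ideal.Quotient.mk_surjective
    haveI : IsLocalRing (R ⧸ Ideal.span {h}) := .of_surjective' _ Ideal.Quotient.mk_surjective
    obtain ⟨n, hn⟩ := Literature.AlgebraicGeometry.Resolution.exists_nat_cast_eq_ringKrullDim (R := R ⧸ Ideal.span {h})
    obtain ⟨n', hn'⟩ := Literature.AlgebraicGeometry.Resolution.exists_nat_cast_eq_ringKrullDim (R := R ⧸ Q)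
    have eP := Literature.AlgebraicGeometry.Resolution.height_add_ringKrullDim_quotient (S := R) (Ideal.span {h})
    have eQ := Literature.AlgebraicGeometry.Resolution.height_add_ringKrullDim_quotient (S := R) Q
    have hh1' : (Ideal.span {h}).height = ((1 : ℕ) : ℕ∞) := by rw [hh1]; rfl
    rw [hh1', hn, hc] at eP
    rw [← hm', hn', hc] at eQ
    rw [← hm'] at h1
    have e1 : 1 + n = c := by exact_mod_cast eP
    have e2 : m' + n' = c := by exact_mod_cast eQ
    have e3 : 1 ≤ m' := by exact_mod_cast h1
    rw [hn, hn']
    have : n' ≤ n := by omega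
    exact_mod_cast this

/-! ### (M2d) σ_top legality of the point step, and (M2) -/

/-- `f − a² ∈ (h)²` for a radicand form `f = a² + b²·f'` with `h ∣ b`. [folklore] -/
theorem sub_sq_mem_span_singleton_sq (R : Subring K) {f a b f' : R} (hf : f = a ^ 2 + b ^ 2 * f') {h : R} (hhb : h ∣ b) :
    f - a ^ 2 ∈ Ideal.span {h} ^ 2 := by
  obtain ⟨c, rfl⟩ := hhb
  have : f - a ^ 2 = h ^ 2 * (c ^ 2 * f') := by rw [hf]; ring
  rw [this]
  exact Ideal.mul_mem_right _ _ (Ideal.pow_mem_pow (Ideal.mem_span_singleton_self h) 2)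

/-- **(M2d)** σ_top-LEGALITY OF THE POINT STEP FORCES THE SINGULAR DIVISOR TO BE NON-REGULAR: if the σ_top centre at `(R, f)` is the
closed point, then every prime factor `h` of `b` lies in `𝔪²` — otherwise `(h)` would be a regular top singular component with
`f − a² ∈ (h)²`, i.e. a permissible centre, and σ_top would strip it instead. Needs `dim R ≥ 2` (I2dim). OURS. [folklore] -/
theorem mem_maximalIdeal_sq_of_isSigmaTopCentre [CharP K 2] (R : Subring K) [IsLocalRing R] (hI2 : IsRegularLocalRing R)
    (hI2dim : (2 : WithBot ℕ∞) ≤ ringKrullDim R) {f a b f' : R} (hf : f = a ^ 2 + b ^ 2 * f') (hI1 : ¬ IsSingPrime R 2 f ⊥)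
    (hlegal : IsSigmaTopCentre R 2 f (maximalIdeal R)) {h : R} (hprime : Prime h) (hhb : h ∣ b) :
    h ∈ maximalIdeal R ^ 2 := by
  haveI := hI2
  by_contra hh2
  have hhm : h ∈ maximalIdeal R := (IsLocalRing.mem_maximalIdeal h).mpr hprime.not_unit
  -- `R ⧸ (h)` is regular and `(h) ≠ 𝔪`
  obtain ⟨hreg, hdim⟩ :=
    Literature.AlgebraicGeometry.Resolution.IsRegularLocalRing.quotient_span_singleton (R := R) hhm hh2
  have hne : Ideal.span {h} ≠ maximalIdeal R := by
    intro heq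
    rw [heq] at hdim
    letI : Field (R ⧸ maximalIdeal R) := Ideal.Quotient.field (maximalIdeal R)
    have h0 : ringKrullDim (R ⧸ maximalIdeal R) = 0 := ringKrullDim_eq_zero_of_isField (Field.toIsField _)
    rw [h0, zero_add] at hdim
    rw [← hdim] at hI2dim
    exact absurd hI2dim (by decide)
  -- hence `(h)` is a permissible centre
  have hperm : IsPermissibleCentre R 2 f (Ideal.span {h}) :=
    ⟨hne, isTopSingComponent_span_of_sqForm R hI2 hf hI1 hprime hhb, hreg,
      ⟨a, sub_sq_mem_span_singleton_sq R hf hhb⟩⟩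
  -- contradicting the σ_top word at the closed point
  rcases hlegal with hP | ⟨-, hno, -⟩
  · exact hP.1 rfl
  · exact hno _ hperm

/-- **(M2)** At a legal σ_top POINT step, the non-unit coefficient `b` of a radicand form `f = a² + b²·f'` lies in `𝔪²` (`μ ≥ 2`):
`R` regular local is a UFD (Auslander–Buchsbaum, `Res.uniqueFactorizationMonoid_of_isRegularLocalRing`), apply (M2d) to a prime
factor of `b` (`b = 0` trivial). OURS. [folklore] -/
theorem sqForm_coeff_mem_maximalIdeal_sq [CharP K 2] (R : Subring K) [IsLocalRing R] (hI2 : IsRegularLocalRing R)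
    (hI2dim : (2 : WithBot ℕ∞) ≤ ringKrullDim R) {f a b f' : R} (hf : f = a ^ 2 + b ^ 2 * f') (hI1 : ¬ IsSingPrime R 2 f ⊥)
    (hlegal : IsSigmaTopCentre R 2 f (maximalIdeal R)) (hb : b ∈ maximalIdeal R) : b ∈ maximalIdeal R ^ 2 := by
  haveI := hI2
  rcases eq_or_ne b 0 with rfl | hb0
  · exact zero_mem _
  haveI : UniqueFactorizationMonoid R :=
    Literature.AlgebraicGeometry.Resolution.uniqueFactorizationMonoid_of_isRegularLocalRing R hI2
  have hbu : ¬ IsUnit b := (IsLocalRing.mem_maximalIdeal b).mp hb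
  obtain ⟨h, hirr, hhb⟩ := WfDvdMonoid.exists_irreducible_factor hbu hb0
  have hprime : Prime h := UniqueFactorizationMonoid.irreducible_iff_prime.mp hirr
  have hh2 := mem_maximalIdeal_sq_of_isSigmaTopCentre R hI2 hI2dim hf hI1 hlegal hprime hhb
  obtain ⟨c, rfl⟩ := hhb
  rw [pow_two] at hh2 ⊢
  -- `h ∈ 𝔪²` ⇒ `h * c ∈ 𝔪²`
  exact Ideal.mul_mem_right c _ hh2

end Summit.ResolutionOfSingularities.ResolutionOfSingularities.Theorems.SwitchingDichotomy.MaxGenShadow
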